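import Literature.Computability.AlgebraicComplexity.LR17EquivariantRepresentations
import Literature.Computability.AlgebraicComplexity.LandsbergRessayreThm21Proofs
import Literature.Computability.AlgebraicComplexity.PermanentVsDeterminant
import Literature.Computability.AlgebraicComplexity.PBoundedGrowth
import HarnessLib

/-!
# Landsberg–Ressayre 2017, §2 — proofs companion of `LR17EquivariantRepresentations.lean`

Topic `Literature/Computability/AlgebraicComplexity` (cell val-lit, typer t12, DAG row LR17-A).
Source: J. M. Landsberg, N. Ressayre, arXiv:1508.05788 = Differential Geom. Appl. 55 (2017)
[LandsbergRessayre2017]; locators `pNNNN:Lnn` refer to the held text `paper:arxiv-1508.05788`.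

Everything here is PROVED (no named facts):

* `IsEquivariantDetRepr.map_C_mul`, `HasRegularEquivariantDetRepr.of_sign`,
  `HasEquivariantDetRepr.of_sign`: multiplying a representation on the left by a constant invertible
  matrix (LR17 §3.3, p0009:L80–L84) keeps it equivariant (lifts conjugated) and regular, and multiplies
  the represented polynomial by the determinant — used to absorb the printed signs `(-1)^{m+1}`,
  `detHalfSign m` of Props. 2.10, 2.16, 2.17.
* `LR17.card_halfIdx : |HalfIdx m| = 2^m - 1`, `LR17.card_fullIdx : |FullIdx m| = C(2m,m) - 1`
  (the printed sizes `n`, p0007:L25 and p0006:L68–L69 / p0007:L83, via Vandermonde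
  `Σ_j C(m,j)² = C(2m,m)`).
* `lr_thm_2_14_le` / `lr_thm_2_14_eq`: Thm. 2.14 (p0006:L135–L142) from the facts `lr_prop_2_16`,
  `lr_thm_2_14_ge`; `lr_thm_2_13_le` / `lr_thm_2_13_eq`: Thm. 2.13 (p0006:L127–L129) from `lr_prop_2_17`,
  `lr_thm_2_13_ge`; `lr_thm_2_1_le` / `lr_thm_2_1_eq`: Thm. 2.1 (p0005:L5–L6) from `lr_prop_2_10` and the
  tree's PROVED lower bound `lr_full_equivariant_lower_holds`.
* `lr_cor_2_3`: **Cor. 2.3** (p0005:L19–L22) PROVED — an affirmative answer to Question 2.2 (spelled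
  out as the hypothesis, junk-free reading of `edc ≤ e(dc)`) implies Conjecture 1.1 in `dc` form,
  `DcPerSuperpolynomial ℂ`; from `lr_full_equivariant_lower_holds` and `4^m ≤ 2m·C(2m,m)`.

Honest framing: Conjecture 1.1 / `VP ≠ VNP` is NOT proved; `lr_cor_2_3` is the printed conditional.
-/

noncomputable section

open MvPolynomial Matrix

namespace Literature.Computability.AlgebraicComplexity

universe u v

/-! ## Constant gauge factors on the left -/

section Absorb

variable {k : Type u} [CommRing k] {σ : Type v} [Fintype σ] [DecidableEq σ]
  {Γ : Subgroup (GL σ k)} {f : MvPolynomial σ k} {n : ℕ}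
  {A : Matrix (Fin n) (Fin n) (MvPolynomial σ k)}

/-- Left multiplication by a constant invertible matrix `P` turns a `Γ`-equivariant representation of
`f` into one of `det P · f` (lifts are conjugated by `P`; LR17 §3.3 "multiplying on the left and right
by constant invertible matrices", p0009:L80–L84). [cite: LandsbergRessayre2017, §3.3] -/
theorem IsEquivariantDetRepr.map_C_mul (hA : IsEquivariantDetRepr Γ f A) (P : GL (Fin n) k) :
    IsEquivariantDetRepr Γ (C (P : Matrix (Fin n) (Fin n) k).det * f)
      ((P : Matrix (Fin n) (Fin n) k).map C * A) := by
  have h := isEquivariantDetRepr_iff_exists_mul_mul.1 hA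
  rw [isEquivariantDetRepr_iff_exists_mul_mul]
  have e1 : ((P : Matrix (Fin n) (Fin n) k).map C * A : Matrix (Fin n) (Fin n) (MvPolynomial σ k)) =
      (P : Matrix (Fin n) (Fin n) k).map C * A *
        ((1 : GL (Fin n) k) : Matrix (Fin n) (Fin n) k).map C := by
    rw [Units.val_one, Matrix.map_one C C_0 C_1, Matrix.mul_one]
  refine ⟨⟨?_, ?_⟩, ?_⟩
  · rw [e1]; exact totalDegree_map_C_mul_mul_map_C_le _ _ h.1.1
  · rw [Matrix.det_mul, det_map_C, h.1.2]
  · rw [e1]; exact forall_exists_lift_mul_mul h.2 P 1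

end Absorb

section SignUnit

variable {k : Type*} [Field k]

/-- A constant invertible matrix of size `n ≥ 1` with determinant a given sign `s` (`s² = 1`):
`diag(s, 1, …, 1)`, its own inverse. [folklore] -/
private theorem LR17.exists_gl_det_eq {n : ℕ} (hn : 0 < n) (s : k) (hs : s * s = 1) :
    ∃ P : GL (Fin n) k, (P : Matrix (Fin n) (Fin n) k).det = s := by
  have hsq : Matrix.diagonal (Function.update (1 : Fin n → k) ⟨0, hn⟩ s) *
      Matrix.diagonal (Function.update (1 : Fin n → k) ⟨0, hn⟩ s) = 1 := by
    rw [Matrix.diagonal_mul_diagonal, ← Matrix.diagonal_one]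
    congr 1; funext i
    by_cases h : i = ⟨0, hn⟩
    · subst h; simp [hs]
    · simp [Function.update_of_ne h]
  refine ⟨⟨_, _, hsq, hsq⟩, ?_⟩
  change (Matrix.diagonal (Function.update (1 : Fin n → k) ⟨0, hn⟩ s)).det = s
  rw [Matrix.det_diagonal, Finset.prod_update_of_mem (Finset.mem_univ _)]
  simp

variable {σ : Type*} [Fintype σ] [DecidableEq σ] {Γ : Subgroup (GL σ k)} {f : MvPolynomial σ k}

/-- A regular `Γ`-equivariant representation of `s · f`, `s² = 1`, of size `n ≥ 1` yields one of `f` of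
the same size (multiply the first row by `s`: lifts are conjugated, the rank of the constant part is
unchanged). [cite: LandsbergRessayre2017, §3.3] -/
theorem HasRegularEquivariantDetRepr.of_sign {s : k} (hs : s * s = 1) {n : ℕ} (hn : 0 < n)
    {A : Matrix (Fin n) (Fin n) (MvPolynomial σ k)}
    (hreg : IsRegularDetRepr (C s * f) A) (heq : IsEquivariantDetRepr Γ (C s * f) A) :
    HasRegularEquivariantDetRepr Γ f n := by
  obtain ⟨P, hdet⟩ := LR17.exists_gl_det_eq hn s hs
  have h1 := heq.map_C_mul P
  rw [hdet, ← mul_assoc, ← map_mul, hs, map_one, one_mul] at h1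
  refine ⟨(P : Matrix (Fin n) (Fin n) k).map C * A, ⟨h1.1, ?_⟩, h1⟩
  rw [constPart_mul, constPart_map_C,
    Matrix.rank_mul_eq_right_of_isUnit_det _ _ (Matrix.isUnits_det_units _)]
  exact hreg.2

/-- Same without regularity: a `Γ`-equivariant representation of `s · f` (`s² = 1`, size `n ≥ 1`) gives
one of `f`. [cite: LandsbergRessayre2017, §3.3] -/
theorem HasEquivariantDetRepr.of_sign {s : k} (hs : s * s = 1) {n : ℕ} (hn : 0 < n)
    {A : Matrix (Fin n) (Fin n) (MvPolynomial σ k)} (heq : IsEquivariantDetRepr Γ (C s * f) A) :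
    HasEquivariantDetRepr Γ f n := by
  obtain ⟨P, hdet⟩ := LR17.exists_gl_det_eq hn s hs
  have h1 := heq.map_C_mul P
  rw [hdet, ← mul_assoc, ← map_mul, hs, map_one, one_mul] at h1
  exact ⟨_, h1⟩

end SignUnit

/-! ### Cardinalities of the index types -/

namespace LR17

/-- `|HalfIdx m| = 2^m - 1` (`n = 2^m - 1`, p0006:L32, p0007:L25). [cite: LandsbergRessayre2017, Prop. 2.16] -/
theorem card_halfIdx (m : ℕ) : Fintype.card (HalfIdx m) = 2 ^ m - 1 := by
  rw [Fintype.card_subtype, Finset.filter_ne', Finset.card_erase_of_mem (Finset.mem_univ _),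
    Finset.card_univ, Fintype.card_finset, Fintype.card_fin]

/-- `Σ_{j ≤ m} C(m,j)² = C(2m,m)` (Vandermonde's identity). [folklore] -/
private theorem sum_range_choose_mul_self (m : ℕ) :
    ∑ j ∈ Finset.range (m + 1), m.choose j * m.choose j = (2 * m).choose m := by
  rw [two_mul, Nat.add_choose_eq, Finset.Nat.sum_antidiagonal_eq_sum_range_succ_mk]
  refine Finset.sum_congr rfl fun j hj => ?_
  rw [Finset.mem_range] at hj
  rw [Nat.choose_symm (by omega)]

/-- `Σ_{S ⊆ [m]} C(m, |S|) = C(2m, m)`. [folklore] -/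
private theorem sum_choose_card (m : ℕ) :
    ∑ S : Finset (Fin m), m.choose S.card = (2 * m).choose m := by
  rw [← Finset.powerset_univ, Finset.sum_powerset_apply_card, Finset.card_univ, Fintype.card_fin]
  simp only [smul_eq_mul]
  exact sum_range_choose_mul_self m

/-- `|FullIdx m| = Σ_{j<m} C(m,j)² = C(2m,m) - 1` (p0006:L68–L69, p0007:L83).
[cite: LandsbergRessayre2017, Prop. 2.17] -/
theorem card_fullIdx (m : ℕ) : Fintype.card (FullIdx m) = (2 * m).choose m - 1 := by
  classical
  -- `FullIdx m` fibres over `HalfIdx m` with fibre the `|S|`-subsets of `[m]`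
  let e : FullIdx m ≃ Σ S : HalfIdx m, {R : Finset (Fin m) // R.card = S.1.card} :=
    { toFun := fun p => ⟨⟨p.1.1, p.2.2⟩, ⟨p.1.2, p.2.1.symm⟩⟩
      invFun := fun q => ⟨(q.1.1, q.2.1), ⟨q.2.2.symm, q.1.2⟩⟩
      left_inv := fun p => by rcases p with ⟨⟨S, R⟩, h1, h2⟩; rfl
      right_inv := fun q => by rcases q with ⟨⟨S, hS⟩, ⟨R, hR⟩⟩; rfl }
  rw [Fintype.card_congr e, Fintype.card_sigma]
  simp only [Fintype.card_finset_len, Fintype.card_fin]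
  -- `Σ_{S ≠ univ} C(m,|S|) = Σ_S C(m,|S|) - C(m,m)`
  have h1 : ∑ S : HalfIdx m, m.choose S.1.card =
      ∑ S ∈ (Finset.univ : Finset (Finset (Fin m))).erase Finset.univ, m.choose S.card := by
    rw [Finset.sum_subtype ((Finset.univ : Finset (Finset (Fin m))).erase Finset.univ)
      (p := fun S : Finset (Fin m) => S ≠ Finset.univ)]
    intro S
    simp [Finset.mem_erase]
  have h2 := Finset.sum_erase_add (Finset.univ : Finset (Finset (Fin m))) (fun S => m.choose S.card)
    (Finset.mem_univ Finset.univ)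
  rw [sum_choose_card, Finset.card_univ, Fintype.card_fin, Nat.choose_self] at h2
  rw [h1]
  omega

end LR17

/-! ### Thm. 2.14 and Thm. 2.13 as equalities; Thm. 2.1; Cor. 2.3 -/

/-- **LR17 Thm. 2.14, "Moreover" half** (p0006:L141–L142) from Prop. 2.16: for `m ≥ 1`, `det_m` has a
regular `GL(E)`-equivariant affine determinantal representation of size `2^m - 1` (the sign
`detHalfSign m = ±1` of Prop. 2.16 is absorbed into the first row). [cite: LandsbergRessayre2017, Thm. 2.14] -/
theorem lr_thm_2_14_le (h16 : lr_prop_2_16) {m : ℕ} (hm : 1 ≤ m) :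
    HasRegularEquivariantDetRepr (leftLinearSubst ℂ m) (detPoly (Fin m) ℂ) (2 ^ m - 1) := by
  obtain ⟨e⟩ : Nonempty (LR17.HalfIdx m ≃ Fin (2 ^ m - 1)) :=
    ⟨Fintype.equivFinOfCardEq (LR17.card_halfIdx m)⟩
  obtain ⟨hreg, heq⟩ := h16 m hm _ e
  have hs : ((LR17.detHalfSign m : ℤ) : ℂ) * ((LR17.detHalfSign m : ℤ) : ℂ) = 1 := by
    unfold LR17.detHalfSign
    split_ifs <;> push_cast <;> norm_num
  have hn : 0 < 2 ^ m - 1 := by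
    have := Nat.one_lt_two_pow (by omega : m ≠ 0)
    omega
  exact HasRegularEquivariantDetRepr.of_sign hs hn hreg heq

/-- **LR17 Thm. 2.14 as an equality**: for `m ≥ 1`, the regular `GL(E)`-equivariant determinantal
complexity of `det_m` is `2^m - 1` (from the facts `lr_prop_2_16` and `lr_thm_2_14_ge`).
[cite: LandsbergRessayre2017, Thm. 2.14] -/
theorem lr_thm_2_14_eq (h16 : lr_prop_2_16) (hge : lr_thm_2_14_ge) {m : ℕ} (hm : 1 ≤ m) :
    regularEquivariantDetComplexity (leftLinearSubst ℂ m) (detPoly (Fin m) ℂ) = 2 ^ m - 1 := by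
  refine le_antisymm (regularEquivariantDetComplexity_le (lr_thm_2_14_le h16 hm)) ?_
  have hmem : HasRegularEquivariantDetRepr (leftLinearSubst ℂ m) (detPoly (Fin m) ℂ)
      (regularEquivariantDetComplexity (leftLinearSubst ℂ m) (detPoly (Fin m) ℂ)) :=
    Nat.sInf_mem (s := {n | HasRegularEquivariantDetRepr (leftLinearSubst ℂ m) (detPoly (Fin m) ℂ) n})
      ⟨_, lr_thm_2_14_le h16 hm⟩
  obtain ⟨A, hreg, heq⟩ := hmem
  exact hge m _ A hreg heq

/-- **LR17 Thm. 2.13, upper half** from Prop. 2.17: for `m ≥ 1`, `det_m` has a regular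
`𝔾_{det_m}`-equivariant affine determinantal representation of size `C(2m,m) - 1` (the sign `(-1)^{m+1}`
of Prop. 2.17 absorbed into the first row). [cite: LandsbergRessayre2017, Thm. 2.13] -/
theorem lr_thm_2_13_le (h17 : lr_prop_2_17) {m : ℕ} (hm : 1 ≤ m) :
    HasRegularEquivariantDetRepr (detSymmetrySubst ℂ m) (detPoly (Fin m) ℂ) ((2 * m).choose m - 1) := by
  obtain ⟨e⟩ : Nonempty (LR17.FullIdx m ≃ Fin ((2 * m).choose m - 1)) :=
    ⟨Fintype.equivFinOfCardEq (LR17.card_fullIdx m)⟩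
  obtain ⟨hreg, heq⟩ := h17 m hm _ e
  have hs : ((-1 : ℂ) ^ (m + 1)) * ((-1 : ℂ) ^ (m + 1)) = 1 := by
    rw [← mul_pow]; norm_num
  have hn : 0 < (2 * m).choose m - 1 := by
    have := Nat.two_le_centralBinom m (by omega)
    rw [Nat.centralBinom_eq_two_mul_choose] at this
    omega
  exact HasRegularEquivariantDetRepr.of_sign hs hn hreg heq

/-- **LR17 Thm. 2.13 as an equality** (p0006:L127–L129, "`\srdc(det_m) = C(2m,m) - 1`"), for `m ≥ 1`,
from the facts `lr_prop_2_17` and `lr_thm_2_13_ge`. [cite: LandsbergRessayre2017, Thm. 2.13] -/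
theorem lr_thm_2_13_eq (h17 : lr_prop_2_17) (hge : lr_thm_2_13_ge) {m : ℕ} (hm : 1 ≤ m) :
    regularEquivariantDetComplexity (detSymmetrySubst ℂ m) (detPoly (Fin m) ℂ) = (2 * m).choose m - 1 := by
  refine le_antisymm (regularEquivariantDetComplexity_le (lr_thm_2_13_le h17 hm)) ?_
  have hmem : HasRegularEquivariantDetRepr (detSymmetrySubst ℂ m) (detPoly (Fin m) ℂ)
      (regularEquivariantDetComplexity (detSymmetrySubst ℂ m) (detPoly (Fin m) ℂ)) :=
    Nat.sInf_mem (s := {n | HasRegularEquivariantDetRepr (detSymmetrySubst ℂ m) (detPoly (Fin m) ℂ) n})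
      ⟨_, lr_thm_2_13_le h17 hm⟩
  obtain ⟨A, hreg, heq⟩ := hmem
  exact hge m _ A hreg heq

/-- **LR17 Thm. 2.1, upper half** (p0005:L5–L6 with Prop. 2.10, p0006:L51–L52 "By Theorem 2.1, its size
is `C(2m,m) - 1`"): for `m ≥ 1`, `perm_m` has a `𝔾_{perm_m}`-equivariant affine determinantal
representation of size `C(2m,m) - 1` (sign `(-1)^{m+1}` of Prop. 2.10 absorbed).
[cite: LandsbergRessayre2017, Thm. 2.1] -/
theorem lr_thm_2_1_le (h10 : lr_prop_2_10) {m : ℕ} (hm : 1 ≤ m) :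
    HasEquivariantDetRepr (permSymmetrySubst ℂ m) (perPoly (Fin m) ℂ) ((2 * m).choose m - 1) := by
  obtain ⟨e⟩ : Nonempty (LR17.FullIdx m ≃ Fin ((2 * m).choose m - 1)) :=
    ⟨Fintype.equivFinOfCardEq (LR17.card_fullIdx m)⟩
  have heq := h10 m hm _ e
  have hs : ((-1 : ℂ) ^ (m + 1)) * ((-1 : ℂ) ^ (m + 1)) = 1 := by
    rw [← mul_pow]; norm_num
  have hn : 0 < (2 * m).choose m - 1 := by
    have := Nat.two_le_centralBinom m (by omega)
    rw [Nat.centralBinom_eq_two_mul_choose] at this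
    omega
  exact HasEquivariantDetRepr.of_sign hs hn heq

/-- **LR17 Thm. 2.1** (p0005:L5–L6): for `m ≥ 3`, `edc(perm_m) = C(2m,m) - 1` — the tree's
`equivariantDetComplexity` for `permSymmetrySubst`, from the PROVED lower bound
`lr_full_equivariant_lower_holds` and the fact `lr_prop_2_10`. [cite: LandsbergRessayre2017, Thm. 2.1] -/
theorem lr_thm_2_1_eq (h10 : lr_prop_2_10) {m : ℕ} (hm : 3 ≤ m) :
    equivariantDetComplexity (permSymmetrySubst ℂ m) (perPoly (Fin m) ℂ) = (2 * m).choose m - 1 :=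
  le_antisymm (equivariantDetComplexity_le (lr_thm_2_1_le h10 (by omega)))
    (le_equivariantDetComplexity_full hm ⟨_, lr_thm_2_1_le h10 (by omega)⟩)

/-- **LR17 Cor. 2.3** (p0005:L19–L22: "Theorem 2.1 implies: If the answer to Question 2.2 is
affirmative, then Conjecture 1.1 is true"), PROVED from the tree's `lr_full_equivariant_lower_holds`.
The hypothesis is Question 2.2 (p0005:L16–L17, "Does there exist a polynomial `e(d)` such that
`edc(perm_m) ≤ e(dc(perm_m))`?") spelled out in the junk-free reading of `edc ≤ N` for LR's
`edc ∈ ℕ ∪ {∞}` (Def. 1.5: SOME `𝔾_{perm_m}`-equivariant representation of size `≤ N` exists), with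
`e(d) = d^c + c` and `m ≥ 3`; the conclusion is Conjecture 1.1 in `dc` form, `DcPerSuperpolynomial ℂ`
(`dc(perm_m)` is not polynomially bounded). Proof as printed: `C(2m,m) - 1 ≤ n ≤ e(dc(perm_m))` and
`4^m ≤ 2m·C(2m,m)`. NOTION CAVEAT (referee note, LMR-3 «TYPED AS»): the hypothesis is Question 2.2 for
the tree's EXACT-LIFT (transposition-free) `edc` (`HasEquivariantDetRepr (permSymmetrySubst ℂ m)`),
which is `≥` LR's `edc` of Def. 1.3/1.5 (lifts in `𝔾_{det_n}`, which contains the transposition); so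
this typed conditional has a STRONGER hypothesis than — is implied by, not equivalent to — the printed
corollary, whose `𝔾_{det_n} ⋊ ℤ₂`-sense `edc` is not vendored in the tree.
[cite: LandsbergRessayre2017, Cor. 2.3] -/
theorem lr_cor_2_3
    (hQ : ∃ c : ℕ, ∀ m : ℕ, 3 ≤ m →
      ∃ n : ℕ, n ≤ determinantalComplexity (perPoly (Fin m) ℂ) ^ c + c ∧
        HasEquivariantDetRepr (permSymmetrySubst ℂ m) (perPoly (Fin m) ℂ) n) :
    DcPerSuperpolynomial ℂ := by
  obtain ⟨c, hc⟩ := hQ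
  intro hdc
  have ht : IsPBounded fun m => determinantalComplexity (perPoly (Fin m) ℂ) ^ c + c + 1 :=
    IsPBounded.add_holds (IsPBounded.add_holds (IsPBounded.pow_holds hdc c) (IsPBounded.const c))
      (IsPBounded.const 1)
  refine not_isPBounded_of_two_pow_le 2 3 (fun m hm => ?_) ht
  obtain ⟨n, hn, A, hA⟩ := hc m hm
  have hlow : (2 * m).choose m - 1 ≤ n := lr_full_equivariant_lower_holds m hm n A hA
  have h4 : 4 ^ m ≤ 2 * m * (2 * m).choose m := by
    have := Nat.four_pow_le_two_mul_self_mul_centralBinom m (by omega)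
    rwa [Nat.centralBinom_eq_two_mul_choose] at this
  have h2 : 2 ^ m ≤ 4 ^ m := Nat.pow_le_pow_left (by norm_num) m
  have h3 : 2 * m ≤ (m + 1) ^ 2 := by nlinarith
  calc 2 ^ m ≤ 2 * m * (2 * m).choose m := h2.trans h4
    _ ≤ (m + 1) ^ 2 * (2 * m).choose m := Nat.mul_le_mul_right _ h3
    _ ≤ (m + 1) ^ 2 * (determinantalComplexity (perPoly (Fin m) ℂ) ^ c + c + 1) :=
        Nat.mul_le_mul_left _ (by omega)

end Literature.Computability.AlgebraicComplexity

end
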